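import Summits.Ventures.Crystal3D.Theorems.StickyWulffConstantNoReconstructionGainCellFluxGlue
import Summits.Ventures.Crystal3D.Theorems.StickyWulffConstantNoReconstructionGainBlanketGlue
import Mathlib.Analysis.InnerProductSpace.Projection.Reflection
import Mathlib.MeasureTheory.Measure.Haar.InnerProductSpace
import Mathlib.Analysis.SpecialFunctions.Integrals.Basic
import Mathlib.Analysis.SpecialFunctions.Sqrt
import Mathlib.Analysis.SpecialFunctions.Trigonometric.InverseDeriv
import Mathlib.MeasureTheory.Integral.IntervalIntegral.FundThmCalculus
import HarnessLib

/-!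
# The blanket disc's contact segment has area `π/18 − 1/(4√3)` — at every axis direction

HONEST FRAMING. Part of the venture `Summits/Ventures/Crystal3D` (cell `crystal3d-full`), helper
`--supports` the crux `NoReconstructionGain` (stmt-Ventures-19144, route
`route-Ventures-StickyWulffConstant`), BLANKET line of planner cf-p1 (gen 14, `lines/blanket/Blanket.lean`).
The coplanar rung `BlanketBoundCoplanar` ("PROVABLE NOW, size L": pointwise Voronoi, a disc with `d ≤ 6`
unit-distance coplanar neighbours keeps at most `π/3 − d (π/18 − 1/(4√3))` of its Voronoi-restricted area)
needs ONE exact area: the CIRCULAR SEGMENT of the disc of radius `1/√3` (the blanket radius) beyond the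
perpendicular bisector of a unit contact, `π/18 − 1/(4√3) = 0.0302` (exactness is forced: the rung is tight at
`d = 6`, the hexagonal cell `√3/2 = π/3 − 6 (π/18 − 1/(4√3))`).  This file computes it, frame-free:

* `segment_integral`: `∫_{1/2}^{1/√3} 2√(1/3 − s²) ds = π/18 − 1/(4√3)` (FTC with the antiderivative
  `s √(1/3 − s²) + (1/3) arcsin (s√3)`);
* `volume_planarSegment`: the planar segment `{s² + t² ≤ 1/3, s > 1/2}` has that area (Fubini);
* `volume_segmentSlab_fin_three`: the unit-height slab over it, in coordinates;
* `exists_linearIsometryEquiv_apply_eq_frame`: for unit `ν ⊥ u` a linear isometry with `ν ↦ e₃`, `u ↦ e₁`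
  (two reflections) — so that
* `volume_segmentSlab`: for every unit `ν`, unit `u ⊥ ν` and centre `c`,
  `volume {y : lateralSq ν c y ≤ 1/3, |⟪y, ν⟫| ≤ 1/2, ⟪y − c, u⟫ > 1/2} = π/18 − 1/(4√3)`.

WHAT THIS IS NOT: the coplanar rung itself (next file); not the blanket bound; rung F-C1 not moved.
-/

noncomputable section

namespace Summit.Ventures.Crystal3D.Theorems

open MeasureTheory Set Real intervalIntegral
open Summit.Ventures.Crystal3D.Cruxes.NoReconstructionGain.CellFlux
open scoped InnerProductSpace

/-- The segment area constant `π/18 − 1/(4√3)` (area of the part of the disc of radius `1/√3` beyond a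
chord at distance `1/2` from the centre). -/
theorem segment_integral :
    ∫ s in (1 / 2 : ℝ)..(Real.sqrt 3)⁻¹, 2 * Real.sqrt (1 / 3 - s ^ 2) =
      Real.pi / 18 - 1 / (4 * Real.sqrt 3) := by
  have h3 : 0 < Real.sqrt 3 := Real.sqrt_pos.2 (by norm_num)
  have h3sq : Real.sqrt 3 ^ 2 = 3 := Real.sq_sqrt (by norm_num)
  have hr : (Real.sqrt 3)⁻¹ ^ 2 = 1 / 3 := by rw [inv_pow, h3sq]; norm_num
  have hrpos : 0 < (Real.sqrt 3)⁻¹ := inv_pos.2 h3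
  -- 1/2 < 1/√3
  have hlt : (1 / 2 : ℝ) < (Real.sqrt 3)⁻¹ := by
    rw [lt_inv_comm₀ (by norm_num) h3]
    have : Real.sqrt 3 < 2 := by
      rw [Real.sqrt_lt' (by norm_num)]; norm_num
    norm_num; linarith
  -- the antiderivative
  set F : ℝ → ℝ := fun s => s * Real.sqrt (1 / 3 - s ^ 2) + 1 / 3 * Real.arcsin (s * Real.sqrt 3)
    with hF
  have hderiv : ∀ s ∈ Ioo (1 / 2 : ℝ) (Real.sqrt 3)⁻¹,
      HasDerivAt F (2 * Real.sqrt (1 / 3 - s ^ 2)) s := by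
    intro s hs
    have hs0 : 0 < s := by linarith [hs.1]
    have hs2 : s ^ 2 < 1 / 3 := by
      have := hs.2
      have h := mul_lt_mul'' this this hs0.le hs0.le
      nlinarith [hr]
    have hpos : 0 < 1 / 3 - s ^ 2 := by linarith
    have hsq : 0 < Real.sqrt (1 / 3 - s ^ 2) := Real.sqrt_pos.2 hpos
    -- derivative of s ↦ 1/3 − s²
    have h1 : HasDerivAt (fun s : ℝ => 1 / 3 - s ^ 2) (-(2 * s)) s := by
      have := (hasDerivAt_pow 2 s).const_sub (1 / 3 : ℝ)
      simpa using this
    have h2 : HasDerivAt (fun s : ℝ => Real.sqrt (1 / 3 - s ^ 2))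
        (-(2 * s) / (2 * Real.sqrt (1 / 3 - s ^ 2))) s := h1.sqrt hpos.ne'
    have h3' : HasDerivAt (fun s : ℝ => s * Real.sqrt (1 / 3 - s ^ 2))
        (1 * Real.sqrt (1 / 3 - s ^ 2) + s * (-(2 * s) / (2 * Real.sqrt (1 / 3 - s ^ 2)))) s :=
      (hasDerivAt_id s).mul h2
    -- derivative of arcsin (s √3)
    have h4 : HasDerivAt (fun s : ℝ => s * Real.sqrt 3) (Real.sqrt 3) s := by
      simpa using (hasDerivAt_id s).mul_const (Real.sqrt 3)
    have hne1 : s * Real.sqrt 3 ≠ -1 := by nlinarith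
    have hne2 : s * Real.sqrt 3 ≠ 1 := by
      intro h
      have : (s * Real.sqrt 3) ^ 2 = 1 := by rw [h]; norm_num
      rw [mul_pow, h3sq] at this
      nlinarith
    have h5' := (Real.hasDerivAt_arcsin hne1 hne2).comp s h4
    have h5 : HasDerivAt (fun s : ℝ => Real.arcsin (s * Real.sqrt 3))
        (1 / Real.sqrt (1 - (s * Real.sqrt 3) ^ 2) * Real.sqrt 3) s := h5'
    have h6 := h3'.add (h5.const_mul (1 / 3 : ℝ))
    -- simplify the derivative
    have hsqrt3 : Real.sqrt (1 - (s * Real.sqrt 3) ^ 2) = Real.sqrt 3 * Real.sqrt (1 / 3 - s ^ 2) := by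
      rw [← Real.sqrt_mul (by norm_num : (0:ℝ) ≤ 3), mul_pow, h3sq]
      congr 1; ring
    have hss : Real.sqrt (1 / 3 - s ^ 2) * Real.sqrt (1 / 3 - s ^ 2) = 1 / 3 - s ^ 2 :=
      Real.mul_self_sqrt hpos.le
    have key : 1 * Real.sqrt (1 / 3 - s ^ 2) + s * (-(2 * s) / (2 * Real.sqrt (1 / 3 - s ^ 2))) +
        1 / 3 * (1 / Real.sqrt (1 - (s * Real.sqrt 3) ^ 2) * Real.sqrt 3) =
        2 * Real.sqrt (1 / 3 - s ^ 2) := by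
      rw [hsqrt3]
      set q := Real.sqrt (1 / 3 - s ^ 2) with hq
      have e1 : s * (-(2 * s) / (2 * q)) = -(s ^ 2 / q) := by
        field_simp
      have e2 : 1 / 3 * (1 / (Real.sqrt 3 * q) * Real.sqrt 3) = 1 / (3 * q) := by
        field_simp
      rw [e1, e2]
      field_simp
      nlinarith [hss, hsq]
    rw [key] at h6
    exact h6
  have hcont : ContinuousOn F (Icc (1 / 2 : ℝ) (Real.sqrt 3)⁻¹) := by
    rw [hF]; fun_prop
  have hint : IntervalIntegrable (fun s : ℝ => 2 * Real.sqrt (1 / 3 - s ^ 2)) volume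
      (1 / 2 : ℝ) (Real.sqrt 3)⁻¹ := by
    apply Continuous.intervalIntegrable; fun_prop
  rw [integral_eq_sub_of_hasDerivAt_of_le hlt.le hcont hderiv hint]
  -- evaluate F at the endpoints
  have hFr : F (Real.sqrt 3)⁻¹ = Real.pi / 6 := by
    simp only [hF]
    rw [hr, sub_self, Real.sqrt_zero, mul_zero, zero_add, inv_mul_cancel₀ h3.ne', Real.arcsin_one]
    ring
  have hF12 : F (1 / 2) = 1 / (4 * Real.sqrt 3) + Real.pi / 9 := by
    simp only [hF]
    have ha : Real.arcsin (1 / 2 * Real.sqrt 3) = Real.pi / 3 := by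
      apply Real.arcsin_eq_of_sin_eq
      · rw [Real.sin_pi_div_three]; ring
      · constructor <;> linarith [Real.pi_pos]
    have hb : Real.sqrt (1 / 3 - (1 / 2 : ℝ) ^ 2) = 1 / (2 * Real.sqrt 3) := by
      have e : (1 / (2 * Real.sqrt 3)) ^ 2 = 1 / 3 - (1 / 2 : ℝ) ^ 2 := by
        rw [div_pow, mul_pow, h3sq]; norm_num
      rw [← e]
      exact Real.sqrt_sq (by positivity)
    rw [ha, hb]
    field_simp
    ring
  rw [hFr, hF12]
  ring


/-- `1/2 < 1/√3`. -/
theorem one_half_lt_inv_sqrt_three : (1 / 2 : ℝ) < (Real.sqrt 3)⁻¹ := by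
  have h3 : 0 < Real.sqrt 3 := Real.sqrt_pos.2 (by norm_num)
  rw [lt_inv_comm₀ (by norm_num) h3]
  have : Real.sqrt 3 < 2 := by
    rw [Real.sqrt_lt' (by norm_num)]; norm_num
  norm_num; linarith

/-- `(1/√3)² = 1/3`. -/
theorem inv_sqrt_three_sq : (Real.sqrt 3)⁻¹ ^ 2 = (1 / 3 : ℝ) := by
  rw [inv_pow, Real.sq_sqrt (by norm_num : (0:ℝ) ≤ 3)]; norm_num

/-- The segment constant is positive. -/
theorem segment_const_pos : 0 < Real.pi / 18 - 1 / (4 * Real.sqrt 3) := by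
  rw [← segment_integral]
  have hlt := one_half_lt_inv_sqrt_three
  apply intervalIntegral.intervalIntegral_pos_of_pos_on
  · apply Continuous.intervalIntegrable; fun_prop
  · intro s hs
    have hs0 : 0 < s := by linarith [hs.1]
    have hs2 : s ^ 2 < 1 / 3 := by
      have h := mul_lt_mul'' hs.2 hs.2 hs0.le hs0.le
      nlinarith [inv_sqrt_three_sq]
    have : 0 < Real.sqrt (1 / 3 - s ^ 2) := Real.sqrt_pos.2 (by linarith)
    linarith
  · exact hlt

/-! ### The planar segment (Fubini) -/

/-- **Area of the planar segment** `{(s,t) : s² + t² ≤ 1/3, s > 1/2}` = `π/18 − 1/(4√3)`. -/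
theorem volume_planarSegment :
    volume {p : ℝ × ℝ | p.1 ^ 2 + p.2 ^ 2 ≤ 1 / 3 ∧ 1 / 2 < p.1} =
      ENNReal.ofReal (Real.pi / 18 - 1 / (4 * Real.sqrt 3)) := by
  set S : Set (ℝ × ℝ) := {p | p.1 ^ 2 + p.2 ^ 2 ≤ 1 / 3 ∧ 1 / 2 < p.1} with hS
  have hmeas : MeasurableSet S := by
    have h1 : Measurable fun p : ℝ × ℝ => p.1 ^ 2 + p.2 ^ 2 :=
      (measurable_fst.pow_const 2).add (measurable_snd.pow_const 2)
    exact (measurableSet_le h1 measurable_const).inter (measurableSet_lt measurable_const measurable_fst)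
  have hlt := one_half_lt_inv_sqrt_three
  set r : ℝ := (Real.sqrt 3)⁻¹ with hrdef
  have hr2 : r ^ 2 = 1 / 3 := inv_sqrt_three_sq
  have hrpos : 0 < r := by rw [hrdef]; exact inv_pos.2 (Real.sqrt_pos.2 (by norm_num))
  -- the slices
  have hslice : ∀ s : ℝ, volume (Prod.mk s ⁻¹' S) =
      (Ioi (1 / 2 : ℝ)).indicator (fun s => ENNReal.ofReal (2 * Real.sqrt (1 / 3 - s ^ 2))) s := by
    intro s
    by_cases hs : 1 / 2 < s
    · rw [indicator_of_mem (mem_Ioi.2 hs)]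
      by_cases hs2 : s ^ 2 ≤ 1 / 3
      · have hset : Prod.mk s ⁻¹' S =
            Icc (-Real.sqrt (1 / 3 - s ^ 2)) (Real.sqrt (1 / 3 - s ^ 2)) := by
          ext t
          simp only [hS, Set.mem_preimage, Set.mem_setOf_eq, Set.mem_Icc]
          rw [← Real.sq_le (by linarith : (0:ℝ) ≤ 1 / 3 - s ^ 2)]
          constructor
          · rintro ⟨h1, -⟩; linarith
          · intro h; exact ⟨by linarith, hs⟩
        rw [hset, Real.volume_Icc]
        congr 1; ring
      · push Not at hs2
        have hset : Prod.mk s ⁻¹' S = ∅ := by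
          ext t
          simp only [hS, Set.mem_preimage, Set.mem_setOf_eq, Set.mem_empty_iff_false, iff_false,
            not_and]
          intro h; nlinarith [sq_nonneg t]
        rw [hset, measure_empty, Real.sqrt_eq_zero'.2 (by linarith)]
        simp
    · rw [indicator_of_notMem (fun h => hs (mem_Ioi.1 h))]
      have hset : Prod.mk s ⁻¹' S = ∅ := by
        ext t
        simp only [hS, Set.mem_preimage, Set.mem_setOf_eq, Set.mem_empty_iff_false, iff_false, not_and]
        intro _; exact hs
      rw [hset, measure_empty]
  rw [Measure.volume_eq_prod, Measure.prod_apply hmeas]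
  rw [show (fun s => volume (Prod.mk s ⁻¹' S)) =
      (Ioi (1 / 2 : ℝ)).indicator (fun s => ENNReal.ofReal (2 * Real.sqrt (1 / 3 - s ^ 2)))
      from funext hslice]
  rw [lintegral_indicator measurableSet_Ioi]
  -- cut the ray at `r`: beyond it the integrand vanishes
  rw [← Ioc_union_Ioi_eq_Ioi hlt.le, lintegral_union measurableSet_Ioi Ioc_disjoint_Ioi_same]
  have hzero : ∫⁻ s in Ioi r, ENNReal.ofReal (2 * Real.sqrt (1 / 3 - s ^ 2)) = 0 := by
    have : ∀ s ∈ Ioi r, ENNReal.ofReal (2 * Real.sqrt (1 / 3 - s ^ 2)) = 0 := by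
      intro s hs
      have hs' : r < s := hs
      have : 1 / 3 - s ^ 2 ≤ 0 := by
        have h := mul_lt_mul'' hs' hs' hrpos.le hrpos.le
        nlinarith [hr2]
      rw [Real.sqrt_eq_zero'.2 this]; simp
    rw [setLIntegral_congr_fun measurableSet_Ioi this]; simp
  rw [hzero, add_zero]
  -- the remaining piece is a Bochner integral
  have hcont : Continuous fun s : ℝ => 2 * Real.sqrt (1 / 3 - s ^ 2) := by fun_prop
  have hint : IntegrableOn (fun s : ℝ => 2 * Real.sqrt (1 / 3 - s ^ 2)) (Ioc (1 / 2) r) volume :=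
    (hcont.integrableOn_Icc).mono_set Ioc_subset_Icc_self
  have hnn : 0 ≤ᵐ[volume.restrict (Ioc (1 / 2) r)] fun s : ℝ => 2 * Real.sqrt (1 / 3 - s ^ 2) :=
    Filter.Eventually.of_forall fun s => by positivity
  rw [← ofReal_integral_eq_lintegral_ofReal hint hnn, ← intervalIntegral.integral_of_le hlt.le,
    segment_integral]

/-! ### The segment slab in coordinates -/

/-- The unit-height slab over the planar segment, in the coordinates of `ℝ³`, has volume
`π/18 − 1/(4√3)`. -/
theorem volume_segmentSlab_fin_three :
    volume {y : EuclideanSpace ℝ (Fin 3) | y 0 ^ 2 + y 1 ^ 2 ≤ 1 / 3 ∧ |y 2| ≤ 1 / 2 ∧ 1 / 2 < y 0} =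
      ENNReal.ofReal (Real.pi / 18 - 1 / (4 * Real.sqrt 3)) := by
  set C' : Set (Fin 3 → ℝ) := {f | f 0 ^ 2 + f 1 ^ 2 ≤ 1 / 3 ∧ |f 2| ≤ 1 / 2 ∧ 1 / 2 < f 0} with hC'
  have hpre : {y : EuclideanSpace ℝ (Fin 3) | y 0 ^ 2 + y 1 ^ 2 ≤ 1 / 3 ∧ |y 2| ≤ 1 / 2 ∧ 1 / 2 < y 0} =
      (WithLp.ofLp : EuclideanSpace ℝ (Fin 3) → (Fin 3 → ℝ)) ⁻¹' C' := by
    ext y; simp [hC']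
  have hC'meas : MeasurableSet C' := by
    have h1 : Measurable fun f : Fin 3 → ℝ => f 0 ^ 2 + f 1 ^ 2 :=
      ((measurable_pi_apply (0 : Fin 3) : Measurable fun f : Fin 3 → ℝ => f 0).pow_const 2).add
        ((measurable_pi_apply (1 : Fin 3) : Measurable fun f : Fin 3 → ℝ => f 1).pow_const 2)
    have h2 : Measurable fun f : Fin 3 → ℝ => |f 2| :=
      continuous_abs.measurable.comp (measurable_pi_apply (2 : Fin 3))
    have h3 : Measurable fun f : Fin 3 → ℝ => f 0 := measurable_pi_apply (0 : Fin 3)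
    rw [hC']
    exact ((measurableSet_le h1 measurable_const).inter
      ((measurableSet_le h2 measurable_const).inter (measurableSet_lt measurable_const h3)))
  rw [hpre, (PiLp.volume_preserving_ofLp (Fin 3)).measure_preimage hC'meas.nullMeasurableSet]
  set D : Set (Fin 2 → ℝ) := {g | g 0 ^ 2 + g 1 ^ 2 ≤ 1 / 3 ∧ 1 / 2 < g 0} with hD
  have hsplit : C' = (MeasurableEquiv.piFinSuccAbove (fun _ : Fin 3 => ℝ) 2) ⁻¹'
      (Icc (-(1 / 2 : ℝ)) (1 / 2) ×ˢ D) := by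
    ext f
    simp only [hC', hD, Set.mem_setOf_eq, Set.mem_preimage, Set.mem_prod, Set.mem_Icc, abs_le]
    simp [MeasurableEquiv.piFinSuccAbove, Fin.removeNth, Fin.succAbove]
    constructor
    · rintro ⟨h1, ⟨h2, h3⟩, h4⟩; exact ⟨⟨by linarith, h3⟩, h1, h4⟩
    · rintro ⟨⟨h2, h3⟩, h1, h4⟩; exact ⟨h1, ⟨by linarith, h3⟩, h4⟩
  rw [hsplit, (volume_preserving_piFinSuccAbove (fun _ : Fin 3 => ℝ) 2).measure_preimage_equiv]
  rw [show (volume : Measure (ℝ × (Fin 2 → ℝ))) = volume.prod volume from rfl, Measure.prod_prod,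
    Real.volume_Icc]
  have hDeq : D = MeasurableEquiv.finTwoArrow ⁻¹' {p : ℝ × ℝ | p.1 ^ 2 + p.2 ^ 2 ≤ 1 / 3 ∧ 1 / 2 < p.1} := by
    ext g
    simp [hD, MeasurableEquiv.finTwoArrow, MeasurableEquiv.piFinTwo]
  rw [hDeq, (volume_preserving_finTwoArrow ℝ).measure_preimage_equiv, volume_planarSegment]
  norm_num

/-! ### A frame adapted to `ν ⊥ u` -/

/-- For unit vectors `ν ⊥ u` of `ℝ³` there is a linear isometry of `ℝ³` with `ν ↦ e₃` and `u ↦ e₁`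
(first reflect `ν` onto `e₃`, then, inside `e₃^⊥`, reflect the image of `u` onto `e₁`). -/
theorem exists_linearIsometryEquiv_apply_eq_frame (ν u : EuclideanSpace ℝ (Fin 3)) (hν : ‖ν‖ = 1)
    (hu : ‖u‖ = 1) (huν : ⟪u, ν⟫_ℝ = 0) :
    ∃ g : EuclideanSpace ℝ (Fin 3) ≃ₗᵢ[ℝ] EuclideanSpace ℝ (Fin 3),
      g ν = EuclideanSpace.single (2 : Fin 3) (1 : ℝ) ∧ g u = EuclideanSpace.single (0 : Fin 3) (1 : ℝ) := by
  set e₃ : EuclideanSpace ℝ (Fin 3) := EuclideanSpace.single (2 : Fin 3) (1 : ℝ) with he₃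
  set e₁ : EuclideanSpace ℝ (Fin 3) := EuclideanSpace.single (0 : Fin 3) (1 : ℝ) with he₁
  have hne₃ : ‖e₃‖ = 1 := norm_e3
  have hne₁ : ‖e₁‖ = 1 := by
    have h : ‖e₁‖ ^ 2 = 1 := by
      rw [he₁, EuclideanSpace.real_norm_sq_eq, Fin.sum_univ_three]; simp
    nlinarith [h, norm_nonneg e₁]
  have h13 : ⟪e₁, e₃⟫_ℝ = 0 := by
    rw [he₁, he₃]; simp [EuclideanSpace.inner_single_left]
  set g₁ : EuclideanSpace ℝ (Fin 3) ≃ₗᵢ[ℝ] EuclideanSpace ℝ (Fin 3) :=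
    Submodule.reflection (ℝ ∙ (ν - e₃))ᗮ with hg₁
  have hg₁ν : g₁ ν = e₃ := Submodule.reflection_sub (by rw [hν, hne₃])
  set u' := g₁ u with hu'
  have hu'n : ‖u'‖ = 1 := by rw [hu', g₁.norm_map, hu]
  have hu'3 : ⟪u', e₃⟫_ℝ = 0 := by rw [hu', ← hg₁ν, g₁.inner_map_map, huν]
  set g₂ : EuclideanSpace ℝ (Fin 3) ≃ₗᵢ[ℝ] EuclideanSpace ℝ (Fin 3) :=
    Submodule.reflection (ℝ ∙ (u' - e₁))ᗮ with hg₂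
  have hg₂u : g₂ u' = e₁ := Submodule.reflection_sub (by rw [hu'n, hne₁])
  have hg₂3 : g₂ e₃ = e₃ := by
    apply Submodule.reflection_mem_subspace_eq_self
    rw [Submodule.mem_orthogonal_singleton_iff_inner_right, inner_sub_left, hu'3, h13, sub_zero]
  refine ⟨g₁.trans g₂, ?_, ?_⟩
  · rw [LinearIsometryEquiv.trans_apply, hg₁ν, hg₂3]
  · rw [LinearIsometryEquiv.trans_apply, ← hu', hg₂u]

/-! ### The segment slab at a general axis -/

/-- **The contact segment of the blanket disc has area `π/18 − 1/(4√3)` in every position**: for a unit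
axis direction `ν`, a unit contact direction `u ⊥ ν` and any centre `c`, the unit-height slab
`{y : lateralSq ν c y ≤ 1/3, |⟪y, ν⟫| ≤ 1/2, ⟪y − c, u⟫ > 1/2}` (the part of the `1/√3`-disc about the
axis through `c` beyond the perpendicular bisector towards the coplanar contact neighbour `c + u`) has
volume `π/18 − 1/(4√3)`. -/
theorem volume_segmentSlab (ν u c : EuclideanSpace ℝ (Fin 3)) (hν : ‖ν‖ = 1) (hu : ‖u‖ = 1)
    (huν : ⟪u, ν⟫_ℝ = 0) :
    volume {y : EuclideanSpace ℝ (Fin 3) |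
        lateralSq ν c y ≤ 1 / 3 ∧ |⟪y, ν⟫_ℝ| ≤ 1 / 2 ∧ 1 / 2 < ⟪y - c, u⟫_ℝ} =
      ENNReal.ofReal (Real.pi / 18 - 1 / (4 * Real.sqrt 3)) := by
  obtain ⟨g, hgν, hgu⟩ := exists_linearIsometryEquiv_apply_eq_frame ν u hν hu huν
  have hνν : ⟪ν, ν⟫_ℝ = 1 := by rw [real_inner_self_eq_norm_sq, hν, one_pow]
  have hνu : ⟪ν, u⟫_ℝ = 0 := by rw [real_inner_comm]; exact huν
  -- translate the axis to the origin
  have htrans : {y : EuclideanSpace ℝ (Fin 3) |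
        lateralSq ν c y ≤ 1 / 3 ∧ |⟪y, ν⟫_ℝ| ≤ 1 / 2 ∧ 1 / 2 < ⟪y - c, u⟫_ℝ} =
      (fun y => y + (-(c - ⟪c, ν⟫_ℝ • ν))) ⁻¹'
        {z : EuclideanSpace ℝ (Fin 3) |
          ‖z‖ ^ 2 - ⟪z, ν⟫_ℝ ^ 2 ≤ 1 / 3 ∧ |⟪z, ν⟫_ℝ| ≤ 1 / 2 ∧ 1 / 2 < ⟪z, u⟫_ℝ} := by
    ext y
    simp only [Set.mem_setOf_eq, Set.mem_preimage]
    have h1 : y + -(c - ⟪c, ν⟫_ℝ • ν) = (y + ⟪c, ν⟫_ℝ • ν) - c := by abel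
    have h2 : ‖y + -(c - ⟪c, ν⟫_ℝ • ν)‖ ^ 2 - ⟪y + -(c - ⟪c, ν⟫_ℝ • ν), ν⟫_ℝ ^ 2 = lateralSq ν c y := by
      rw [h1]
      have := lateralSq_add_smul ν c y hν ⟪c, ν⟫_ℝ
      unfold lateralSq at this ⊢
      exact this
    have h3 : ⟪y + -(c - ⟪c, ν⟫_ℝ • ν), ν⟫_ℝ = ⟪y, ν⟫_ℝ := by
      rw [inner_add_left, inner_neg_left, inner_sub_left, inner_smul_left, hνν]; simp
    have h4 : ⟪y + -(c - ⟪c, ν⟫_ℝ • ν), u⟫_ℝ = ⟪y - c, u⟫_ℝ := by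
      rw [h1, inner_sub_left, inner_sub_left, inner_add_left, inner_smul_left, hνu]; simp
    rw [h2, h3, h4]
  -- rotate the frame
  have hrot : {z : EuclideanSpace ℝ (Fin 3) |
        ‖z‖ ^ 2 - ⟪z, ν⟫_ℝ ^ 2 ≤ 1 / 3 ∧ |⟪z, ν⟫_ℝ| ≤ 1 / 2 ∧ 1 / 2 < ⟪z, u⟫_ℝ} =
      g ⁻¹' {y : EuclideanSpace ℝ (Fin 3) | y 0 ^ 2 + y 1 ^ 2 ≤ 1 / 3 ∧ |y 2| ≤ 1 / 2 ∧ 1 / 2 < y 0} := by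
    ext z
    simp only [Set.mem_setOf_eq, Set.mem_preimage]
    have hin : ⟪z, ν⟫_ℝ = (g z) 2 := by
      rw [← g.inner_map_map z ν, hgν]; simp [EuclideanSpace.inner_single_right]
    have hin' : ⟪z, u⟫_ℝ = (g z) 0 := by
      rw [← g.inner_map_map z u, hgu]; simp [EuclideanSpace.inner_single_right]
    have hnorm : ‖z‖ ^ 2 = (g z) 0 ^ 2 + (g z) 1 ^ 2 + (g z) 2 ^ 2 := by
      rw [← g.norm_map z, EuclideanSpace.real_norm_sq_eq, Fin.sum_univ_three]
    rw [hin, hin', hnorm]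
    constructor
    · rintro ⟨h1, h2, h3⟩; exact ⟨by linarith, h2, h3⟩
    · rintro ⟨h1, h2, h3⟩; exact ⟨by linarith, h2, h3⟩
  have hmeas : MeasurableSet
      {y : EuclideanSpace ℝ (Fin 3) | y 0 ^ 2 + y 1 ^ 2 ≤ 1 / 3 ∧ |y 2| ≤ 1 / 2 ∧ 1 / 2 < y 0} := by
    have hc : ∀ i : Fin 3, Continuous fun y : EuclideanSpace ℝ (Fin 3) => y i :=
      fun i => (EuclideanSpace.proj i).continuous
    have h1 : Measurable fun y : EuclideanSpace ℝ (Fin 3) => y 0 ^ 2 + y 1 ^ 2 :=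
      (((hc 0).pow 2).add ((hc 1).pow 2)).measurable
    have h2 : Measurable fun y : EuclideanSpace ℝ (Fin 3) => |y 2| :=
      (continuous_abs.comp (hc 2)).measurable
    exact (measurableSet_le h1 measurable_const).inter
      ((measurableSet_le h2 measurable_const).inter (measurableSet_lt measurable_const (hc 0).measurable))
  rw [htrans, measure_preimage_add_right, hrot, g.measurePreserving.measure_preimage hmeas.nullMeasurableSet,
    volume_segmentSlab_fin_three]

end Summit.Ventures.Crystal3D.Theorems

end
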